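import Mathlib.Data.Int.Interval
import Mathlib.Data.Set.Card
import Mathlib.Algebra.Order.BigOperators.Group.Finset
import Mathlib.Algebra.Order.Ring.Abs
import Mathlib.Data.Real.Basic
import Mathlib.Tactic.Positivity
import Mathlib.Tactic.Linarith
import Mathlib.Tactic.FieldSimp
import Mathlib.Tactic.Ring
import Mathlib.Tactic.Push

/-!
# Crux `HcpLandscapeGap` (stmt-AtomisticToContinuum-12087), line `birth` — stub `stub_fibreCharge`

STUB X1 of the skeleton `Cruxes/HcpLandscapeGap/Lines/birth.lean`: pure one-dimensional
counting used in the assembly of the energy inequality for relaxed Barlow multilattices.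
In a vertical fibre of layers `k ∈ [M₁, M₂]` a site is *bad* only if the in-layer scale is off
(`δ₁ < |a' - a|`; then all sites are bad), or there is a cubic bond `s (k' + 1) = s k'` within `K`
layers, or a spacing `H (k' + 1) - H k'` off `h` by more than `δ₁` within `K` layers.  With the
column price `P = ∑_{k ∈ [M₁, M₂]} ([s (k+1) = s k] + (a' - a)² + (H (k+1) - H k - h)²)` we show
`#bad ≤ (2K+1)(1 + δ₁⁻²) P + 4K(2K+1)`:

* if `δ₁ < |a' - a|`, then `#bad ≤ #[M₁, M₂] ≤ δ₁⁻² ∑_k (a' - a)² ≤ δ₁⁻² P`;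
* otherwise `bad ⊆ {k : ∃ fault k', |k' - k| ≤ K} ∪ {k : ∃ off-spacing k', |k' - k| ≤ K}`, and for
  any predicate `Q`, `#{k ∈ [M₁, M₂] : ∃ k', |k' - k| ≤ K ∧ Q k'} ≤ (2K+1) #{k' ∈ [M₁-K, M₂+K] : Q k'}
  ≤ (2K+1) (#{k' ∈ [M₁, M₂] : Q k'} + 2K)`; finally `#faults = ∑ [s (k+1) = s k] ≤ P` and
  `#off ≤ δ₁⁻² ∑ (H (k+1) - H k - h)² ≤ δ₁⁻² P`.

All [folklore] (elementary counting).
-/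

namespace Summit.AtomisticToContinuum.Crystallization.Theorems.HcpLandscapeGapBirth

open Finset

namespace FibreCharge

/-- Window count: the layers of `[M₁, M₂]` within distance `K` of a layer satisfying `Q` number at
most `(2K+1) (#{k' ∈ [M₁, M₂] : Q k'} + 2K)`. [folklore] -/
theorem card_window_le (K : ℕ) (Q : ℤ → Prop) [DecidablePred Q] (M₁ M₂ : ℤ)
    [DecidablePred fun k : ℤ => ∃ k' : ℤ, |k' - k| ≤ (K : ℤ) ∧ Q k'] :
    #((Icc M₁ M₂).filter fun k => ∃ k' : ℤ, |k' - k| ≤ (K : ℤ) ∧ Q k') ≤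
      (2 * K + 1) * (#((Icc M₁ M₂).filter Q) + 2 * K) := by
  -- every bad layer lies in the window of a `Q`-layer of the enlarged interval
  have hcover : ((Icc M₁ M₂).filter fun k => ∃ k' : ℤ, |k' - k| ≤ (K : ℤ) ∧ Q k') ⊆
      ((Icc (M₁ - K) (M₂ + K)).filter Q).biUnion fun k' => Icc (k' - K) (k' + K) := by
    intro k hk
    simp only [mem_filter, mem_Icc] at hk
    obtain ⟨⟨h1, h2⟩, k', hk', hQ⟩ := hk
    rw [abs_le] at hk'
    simp only [mem_biUnion, mem_filter, mem_Icc]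
    exact ⟨k', ⟨⟨by omega, by omega⟩, hQ⟩, by omega, by omega⟩
  have hwin : ∀ k' ∈ (Icc (M₁ - K) (M₂ + K)).filter Q, #(Icc (k' - K) (k' + K)) ≤ 2 * K + 1 := by
    intro k' _
    rw [Int.card_Icc]
    omega
  -- the `Q`-layers of the enlarged interval exceed those of `[M₁, M₂]` by at most `2K`
  have hwide : #((Icc (M₁ - K) (M₂ + K)).filter Q) ≤ #((Icc M₁ M₂).filter Q) + 2 * K := by
    have hsub : (Icc (M₁ - K) (M₂ + K)).filter Q ⊆
        (Icc M₁ M₂).filter Q ∪ (Icc (M₁ - K) (M₁ - 1) ∪ Icc (M₂ + 1) (M₂ + K)) := by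
      intro x hx
      simp only [mem_filter, mem_Icc, mem_union] at hx ⊢
      obtain ⟨⟨h1, h2⟩, hQ⟩ := hx
      by_cases h3 : M₁ ≤ x ∧ x ≤ M₂
      · exact Or.inl ⟨h3, hQ⟩
      · right
        omega
    calc #((Icc (M₁ - K) (M₂ + K)).filter Q)
        ≤ #((Icc M₁ M₂).filter Q ∪ (Icc (M₁ - K) (M₁ - 1) ∪ Icc (M₂ + 1) (M₂ + K))) :=
          card_le_card hsub
      _ ≤ #((Icc M₁ M₂).filter Q) + #(Icc (M₁ - K) (M₁ - 1) ∪ Icc (M₂ + 1) (M₂ + K)) :=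
          card_union_le _ _
      _ ≤ #((Icc M₁ M₂).filter Q) + (#(Icc (M₁ - ↑K) (M₁ - 1)) + #(Icc (M₂ + 1) (M₂ + ↑K))) :=
          Nat.add_le_add_left (card_union_le _ _) _
      _ = #((Icc M₁ M₂).filter Q) + 2 * K := by
          rw [Int.card_Icc, Int.card_Icc]
          omega
  calc #((Icc M₁ M₂).filter fun k => ∃ k' : ℤ, |k' - k| ≤ (K : ℤ) ∧ Q k')
      ≤ #(((Icc (M₁ - K) (M₂ + K)).filter Q).biUnion fun k' => Icc (k' - K) (k' + K)) :=
        card_le_card hcover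
    _ ≤ #((Icc (M₁ - K) (M₂ + K)).filter Q) * (2 * K + 1) := card_biUnion_le_card_mul _ _ _ hwin
    _ ≤ (#((Icc M₁ M₂).filter Q) + 2 * K) * (2 * K + 1) := Nat.mul_le_mul_right _ hwide
    _ = (2 * K + 1) * (#((Icc M₁ M₂).filter Q) + 2 * K) := Nat.mul_comm _ _

/-- Chebyshev count: if every element of `t ⊆ s` has `f`-value at least `c > 0` and `f ≥ 0` on `s`,
then `#t ≤ c⁻¹ ∑_{s} f`. [folklore] -/
theorem card_le_inv_mul_sum {s t : Finset ℤ} (hts : t ⊆ s) (f : ℤ → ℝ) {c : ℝ} (hc : 0 < c)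
    (hf : ∀ k ∈ s, 0 ≤ f k) (ht : ∀ k ∈ t, c ≤ f k) :
    (#t : ℝ) ≤ c⁻¹ * ∑ k ∈ s, f k := by
  have h1 : (#t : ℝ) * c ≤ ∑ k ∈ t, f k := by
    have := card_nsmul_le_sum t f c ht
    rwa [nsmul_eq_mul] at this
  have h2 : ∑ k ∈ t, f k ≤ ∑ k ∈ s, f k :=
    sum_le_sum_of_subset_of_nonneg hts fun k hk _ => hf k hk
  rw [← div_eq_inv_mul, le_div_iff₀ hc]
  exact h1.trans h2

end FibreCharge

open FibreCharge in
/-- **Stub X1 (`stub_fibreCharge`).**  In a fibre of layers `k ∈ [M₁, M₂]`, the number of layers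
that see an off in-layer scale, a cubic bond within `K` layers, or an off spacing within `K`
layers is at most `(2K+1)(1 + δ₁⁻²) P + 4K(2K+1)`, where
`P = ∑_{k ∈ [M₁, M₂]} ([s (k+1) = s k] + (a' - a)² + (H (k+1) - H k - h)²)` is the column price.
[folklore] -/
theorem stub_fibreCharge : ∀ (K : ℕ) (δ₁ : ℝ), 0 < δ₁ → ∀ (s : ℤ → ℤ) (H : ℤ → ℝ)
    (a a' h : ℝ) (M₁ M₂ : ℤ), (Set.ncard {k : ℤ | M₁ ≤ k ∧ k ≤ M₂ ∧ (δ₁ < |a' - a| ∨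
      (∃ k' : ℤ, |k' - k| ≤ K ∧ s (k' + 1) = s k') ∨
      (∃ k' : ℤ, |k' - k| ≤ K ∧ δ₁ < |H (k' + 1) - H k' - h|))} : ℝ) ≤
    (2 * K + 1) * (1 + δ₁⁻¹ ^ 2) * (∑ k ∈ Finset.Icc M₁ M₂, ((if s (k + 1) = s k then (1 : ℝ)
      else 0) + (a' - a) ^ 2 + (H (k + 1) - H k - h) ^ 2)) + 4 * K * (2 * K + 1) := by
  intro K δ₁ hδ s H a a' h M₁ M₂
  classical
  -- the column price and its summand
  set f : ℤ → ℝ := fun k =>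
    (if s (k + 1) = s k then (1 : ℝ) else 0) + (a' - a) ^ 2 + (H (k + 1) - H k - h) ^ 2 with hf
  have hf0 : ∀ k ∈ Icc M₁ M₂, 0 ≤ f k := fun k _ => by simp only [hf]; positivity
  have hP0 : 0 ≤ ∑ k ∈ Icc M₁ M₂, f k := sum_nonneg hf0
  have hK0 : (0 : ℝ) ≤ 2 * K + 1 := by positivity
  have hK1 : (1 : ℝ) ≤ 2 * K + 1 := by linarith [(Nat.cast_nonneg K : (0 : ℝ) ≤ K)]
  have hδ2 : 0 < δ₁ ^ 2 := by positivity
  have hi0 : (0 : ℝ) ≤ δ₁⁻¹ ^ 2 := by positivity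
  by_cases ha : δ₁ < |a' - a|
  · -- case (i): all layers are bad, and each summand exceeds `δ₁²`
    have hsub : {k : ℤ | M₁ ≤ k ∧ k ≤ M₂ ∧ (δ₁ < |a' - a| ∨
        (∃ k' : ℤ, |k' - k| ≤ K ∧ s (k' + 1) = s k') ∨
        (∃ k' : ℤ, |k' - k| ≤ K ∧ δ₁ < |H (k' + 1) - H k' - h|))} ⊆ ↑(Icc M₁ M₂) := by
      intro k hk
      simp only [Set.mem_setOf_eq] at hk
      simp only [coe_Icc, Set.mem_Icc]
      exact ⟨hk.1, hk.2.1⟩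
    have h1 := Set.ncard_le_ncard hsub (Finset.finite_toSet _)
    rw [Set.ncard_coe_finset] at h1
    have h2 : (#(Icc M₁ M₂) : ℝ) ≤ (δ₁ ^ 2)⁻¹ * ∑ k ∈ Icc M₁ M₂, f k := by
      refine card_le_inv_mul_sum (subset_refl _) f hδ2 hf0 fun k _ => ?_
      have hsq : δ₁ ^ 2 < (a' - a) ^ 2 := sq_lt_sq.mpr (by rwa [abs_of_pos hδ])
      have : (0 : ℝ) ≤ (if s (k + 1) = s k then (1 : ℝ) else 0) := by positivity
      simp only [hf]
      nlinarith [sq_nonneg (H (k + 1) - H k - h)]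
    rw [← inv_pow] at h2
    have h3 : δ₁⁻¹ ^ 2 * ∑ k ∈ Icc M₁ M₂, f k ≤
        (2 * K + 1) * (δ₁⁻¹ ^ 2 * ∑ k ∈ Icc M₁ M₂, f k) :=
      le_mul_of_one_le_left (mul_nonneg hi0 hP0) hK1
    have h4 : (0 : ℝ) ≤ (2 * K + 1) * ∑ k ∈ Icc M₁ M₂, f k := mul_nonneg hK0 hP0
    have h5 : (0 : ℝ) ≤ 4 * K * (2 * K + 1) := by positivity
    calc (Set.ncard {k : ℤ | M₁ ≤ k ∧ k ≤ M₂ ∧ (δ₁ < |a' - a| ∨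
          (∃ k' : ℤ, |k' - k| ≤ K ∧ s (k' + 1) = s k') ∨
          (∃ k' : ℤ, |k' - k| ≤ K ∧ δ₁ < |H (k' + 1) - H k' - h|))} : ℝ)
        ≤ #(Icc M₁ M₂) := by exact_mod_cast h1
      _ ≤ δ₁⁻¹ ^ 2 * ∑ k ∈ Icc M₁ M₂, f k := h2
      _ ≤ (2 * K + 1) * (1 + δ₁⁻¹ ^ 2) * (∑ k ∈ Icc M₁ M₂, f k) + 4 * K * (2 * K + 1) := by
          nlinarith [h3, h4, h5]
  · -- case (ii): bad layers see a fault or an off spacing within `K` layers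
    set BF : Finset ℤ := (Icc M₁ M₂).filter fun k =>
      ∃ k' : ℤ, |k' - k| ≤ (K : ℤ) ∧ s (k' + 1) = s k' with hBF
    set BO : Finset ℤ := (Icc M₁ M₂).filter fun k =>
      ∃ k' : ℤ, |k' - k| ≤ (K : ℤ) ∧ δ₁ < |H (k' + 1) - H k' - h| with hBO
    have hsub : {k : ℤ | M₁ ≤ k ∧ k ≤ M₂ ∧ (δ₁ < |a' - a| ∨
        (∃ k' : ℤ, |k' - k| ≤ K ∧ s (k' + 1) = s k') ∨
        (∃ k' : ℤ, |k' - k| ≤ K ∧ δ₁ < |H (k' + 1) - H k' - h|))} ⊆ ↑(BF ∪ BO) := by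
      intro k hk
      simp only [Set.mem_setOf_eq] at hk
      obtain ⟨h1, h2, h3⟩ := hk
      rcases h3 with h3 | h3 | h3
      · exact absurd h3 ha
      · simp only [coe_union, Set.mem_union, mem_coe, hBF, mem_filter, mem_Icc]
        exact Or.inl ⟨⟨h1, h2⟩, h3⟩
      · simp only [coe_union, Set.mem_union, mem_coe, hBO, mem_filter, mem_Icc]
        exact Or.inr ⟨⟨h1, h2⟩, h3⟩
    have h1 := Set.ncard_le_ncard hsub (Finset.finite_toSet _)
    rw [Set.ncard_coe_finset] at h1
    -- window counts
    have hF := card_window_le K (fun k => s (k + 1) = s k) M₁ M₂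
    have hO := card_window_le K (fun k => δ₁ < |H (k + 1) - H k - h|) M₁ M₂
    have hnat : Set.ncard {k : ℤ | M₁ ≤ k ∧ k ≤ M₂ ∧ (δ₁ < |a' - a| ∨
        (∃ k' : ℤ, |k' - k| ≤ K ∧ s (k' + 1) = s k') ∨
        (∃ k' : ℤ, |k' - k| ≤ K ∧ δ₁ < |H (k' + 1) - H k' - h|))} ≤
        (2 * K + 1) * (#((Icc M₁ M₂).filter fun k => s (k + 1) = s k) + 2 * K) +
        (2 * K + 1) * (#((Icc M₁ M₂).filter fun k => δ₁ < |H (k + 1) - H k - h|) + 2 * K) := by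
      calc _ ≤ #(BF ∪ BO) := h1
        _ ≤ #BF + #BO := card_union_le _ _
        _ ≤ _ := by
            simp only [hBF, hBO]
            exact Nat.add_le_add (by convert hF) (by convert hO)
    have hreal : (Set.ncard {k : ℤ | M₁ ≤ k ∧ k ≤ M₂ ∧ (δ₁ < |a' - a| ∨
        (∃ k' : ℤ, |k' - k| ≤ K ∧ s (k' + 1) = s k') ∨
        (∃ k' : ℤ, |k' - k| ≤ K ∧ δ₁ < |H (k' + 1) - H k' - h|))} : ℝ) ≤
        (2 * K + 1) * (#((Icc M₁ M₂).filter fun k => s (k + 1) = s k) + 2 * K) +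
        (2 * K + 1) * (#((Icc M₁ M₂).filter fun k => δ₁ < |H (k + 1) - H k - h|) + 2 * K) := by
      exact_mod_cast hnat
    -- faults and off spacings are paid by the column price
    have hcF : (#((Icc M₁ M₂).filter fun k => s (k + 1) = s k) : ℝ) ≤ ∑ k ∈ Icc M₁ M₂, f k := by
      have := card_le_inv_mul_sum (filter_subset (fun k => s (k + 1) = s k) (Icc M₁ M₂)) f
        one_pos hf0 fun k hk => by
          simp only [mem_filter] at hk
          simp only [hf, hk.2, if_true]
          nlinarith [sq_nonneg (a' - a), sq_nonneg (H (k + 1) - H k - h)]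
      simpa using this
    have hcO : (#((Icc M₁ M₂).filter fun k => δ₁ < |H (k + 1) - H k - h|) : ℝ) ≤
        δ₁⁻¹ ^ 2 * ∑ k ∈ Icc M₁ M₂, f k := by
      rw [inv_pow]
      refine card_le_inv_mul_sum (filter_subset _ (Icc M₁ M₂)) f hδ2 hf0 fun k hk => ?_
      simp only [mem_filter] at hk
      have hsq : δ₁ ^ 2 < (H (k + 1) - H k - h) ^ 2 := sq_lt_sq.mpr (by rw [abs_of_pos hδ]; exact hk.2)
      have : (0 : ℝ) ≤ (if s (k + 1) = s k then (1 : ℝ) else 0) := by positivity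
      simp only [hf]
      nlinarith [sq_nonneg (a' - a)]
    have e1 := mul_le_mul_of_nonneg_left hcF hK0
    have e2 := mul_le_mul_of_nonneg_left hcO hK0
    nlinarith [e1, e2, hreal]

end Summit.AtomisticToContinuum.Crystallization.Theorems.HcpLandscapeGapBirth
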